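import Summits.Ventures.PackingBounds.ThreePointCert.Soundness

/-!
# A cheaper kernel validation of the three-point part `FI` (Gram form of the weight vectors)

Framing: lottery ticket; floor = certified bounds/negative ranges. Venture `PackingBounds`
(cell `pub-packcert`), three-point SDP family.

`ThreePointCert.Check.FPolyG` expands the three-point part block by block as
`M_k · Σ_w Σ_{a,b} w_a w_b · sym6(u^a v^b QI_k)`, i.e. once per weight vector `w` of the block. Here the
weight vectors are first contracted into their integer Gram matrix `G_{ab} = Σ_w w_a w_b` (`gramW`)
and the tables are scaled once per entry: `FbPolyK = M_k · Σ_{a,b<L} G_{ab} · sym6(u^a v^b QI_k)`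
(`L` = the longest weight vector). This is `rank(F_k)` times less kernel work and memory — at
n = 7, d = 12 the per-weight-vector form exceeds the kernel's memory bound for the blocks k = 2…7,
the Gram form validates each block in about a minute. `eval_FPolyK` proves the two programs have
the same value everywhere, so a successful `FchunkOKK` gives the chunk validity `FChunkVal` of
`ThreePointCert.Soundness` (`fchunkVal_of_okFK`) and the final assembly (`fexpValidG_of_fchunkVal`,
`card_le_of_cert3`) is unchanged. No statement about certificates changes.
-/

noncomputable section

namespace Summit.Ventures.PackingBounds.ThreePointCert

open Finset
open Literature.Geometry.DiscreteGeometry Literature.Geometry.DiscreteGeometry.PolyCert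
open Literature.Geometry.DiscreteGeometry.PolyCert.SPoly

/-- Longest weight vector of a block. -/
def maxLenZ (L : List (List ℤ)) : ℕ := (L.map List.length).foldr max 0

/-- Integer Gram entry of the weight vectors: `Σ_w w_a w_b`. -/
def gramW (ws : List (List ℤ)) (a b : ℕ) : ℤ := (ws.map fun w => w.getD a 0 * w.getD b 0).sum

/-- One block in Gram form: `M_k · Σ_{a,b<L} G_{ab} · symTabG n k a b`. -/
def FbPolyK (n d : ℕ) (b : FBlk) : SPoly :=
  smul (Mfac d b.k : ℤ) (mergeAll ((List.range (maxLenZ b.ws)).map fun a =>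
    mergeAll ((List.range (maxLenZ b.ws)).map fun b' => smul (gramW b.ws a b') (symTabG n b.k a b'))))

/-- The three-point part in Gram form. -/
def FPolyK (n d : ℕ) (bs : List FBlk) : SPoly := mergeAll (bs.map (FbPolyK n d))

/-- Block-chunk check in Gram form: `Dprev + FPolyK bs - Dnext ≡ 0` on the box. -/
def FchunkOKK (n d : ℕ) (bs : List FBlk) (Dprev Dnext : SPoly) : Bool :=
  residualBound (Dprev ++ FPolyK n d bs ++ neg Dnext) 0

/-! ### Same value as `FPolyG` -/

/-- Members are no longer than `maxLenZ`. -/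
theorem length_le_maxLenZ (L : List (List ℤ)) (w : List ℤ) (h : w ∈ L) : w.length ≤ maxLenZ L := by
  induction L with
  | nil => simp at h
  | cons r rs ih =>
    simp only [maxLenZ, List.map_cons, List.foldr_cons] at *
    rcases List.mem_cons.1 h with rfl | h'
    · exact le_max_left _ _
    · exact (ih h').trans (le_max_right _ _)

/-- `gramW` of a `cons`. -/
theorem gramW_cons (w : List ℤ) (ws : List (List ℤ)) (a b : ℕ) :
    gramW (w :: ws) a b = w.getD a 0 * w.getD b 0 + gramW ws a b := by
  simp [gramW]

/-- `gramW` of `[]`. -/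
@[simp] theorem gramW_nil (a b : ℕ) : gramW [] a b = 0 := by simp [gramW]

/-- Value of one weight vector's expansion as a double `Finset` sum. -/
theorem eval_FwPolyG_sum (n k : ℕ) (w : List ℤ) (u v t : ℝ) :
    eval (FwPolyG n k w) u v t = ∑ a ∈ range w.length, ∑ b ∈ range w.length,
      ((w.getD a 0 * w.getD b 0 : ℤ) : ℝ) * eval (symTabG n k a b) u v t := by
  simp only [FwPolyG, eval_mergeAll, List.map_map, Function.comp_def, list_sum_map_range, eval_smul]

/-- Extending the ranges of one weight vector's double sum to `L ≥ |w|` (the extra terms vanish). -/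
theorem sum_extend (n k : ℕ) (w : List ℤ) (L : ℕ) (hL : w.length ≤ L) (u v t : ℝ) :
    (∑ a ∈ range w.length, ∑ b ∈ range w.length,
      ((w.getD a 0 * w.getD b 0 : ℤ) : ℝ) * eval (symTabG n k a b) u v t) =
    ∑ a ∈ range L, ∑ b ∈ range L,
      ((w.getD a 0 * w.getD b 0 : ℤ) : ℝ) * eval (symTabG n k a b) u v t := by
  have hz : ∀ a, w.length ≤ a → w.getD a 0 = 0 := fun a ha => by
    rw [List.getD_eq_getElem?_getD, List.getElem?_eq_none_iff.2 ha]; rfl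
  have hsub : range w.length ⊆ range L := range_subset_range.2 hL
  rw [sum_subset hsub (fun a _ ha => ?_)]
  · refine sum_congr rfl fun a _ => sum_subset hsub fun b _ hb => ?_
    have hb' : w.length ≤ b := by simpa using hb
    rw [hz b hb']; simp
  · have ha' : w.length ≤ a := by simpa using ha
    refine sum_eq_zero fun b _ => ?_
    rw [hz a ha']; simp

/-- The per-weight-vector sum over a block equals the Gram-form sum (any `L` bounding the lengths). -/
theorem sum_ws_eq_gram (n k : ℕ) (u v t : ℝ) (L : ℕ) :
    ∀ ws : List (List ℤ), (∀ w ∈ ws, w.length ≤ L) →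
      (ws.map fun w => eval (FwPolyG n k w) u v t).sum =
        ∑ a ∈ range L, ∑ b ∈ range L, (gramW ws a b : ℝ) * eval (symTabG n k a b) u v t
  | [], _ => by simp
  | w :: ws, h => by
    have hw : w.length ≤ L := h w (by simp)
    have ih := sum_ws_eq_gram n k u v t L ws (fun x hx => h x (by simp [hx]))
    rw [List.map_cons, List.sum_cons, ih, eval_FwPolyG_sum, sum_extend n k w L hw, ← sum_add_distrib]
    refine sum_congr rfl fun a _ => ?_
    rw [← sum_add_distrib]
    refine sum_congr rfl fun b _ => ?_
    rw [gramW_cons]; push_cast; ring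

/-- One block: the Gram form has the value of `FbPolyG`. -/
theorem eval_FbPolyK (n d : ℕ) (b : FBlk) (u v t : ℝ) :
    eval (FbPolyK n d b) u v t = eval (FbPolyG n d b) u v t := by
  simp only [FbPolyK, FbPolyG, eval_smul, eval_mergeAll, List.map_map, Function.comp_def,
    list_sum_map_range]
  rw [sum_ws_eq_gram n b.k u v t (maxLenZ b.ws) b.ws (fun w hw => length_le_maxLenZ b.ws w hw)]

/-- **Same value**: `eval (FPolyK n d bs) = eval (FPolyG n d bs)`. -/
theorem eval_FPolyK (n d : ℕ) (bs : List FBlk) (u v t : ℝ) :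
    eval (FPolyK n d bs) u v t = eval (FPolyG n d bs) u v t := by
  simp only [FPolyK, FPolyG, eval_mergeAll, List.map_map, Function.comp_def, eval_FbPolyK]

/-- Chunk validity (`ThreePointCert.Soundness.FChunkVal`) from a Gram-form kernel chunk check. -/
theorem fchunkVal_of_okFK (c : Cert3) (bs : List FBlk) (Dprev Dnext : SPoly)
    (h : FchunkOKK c.n c.d bs Dprev Dnext = true) : FChunkVal c bs Dprev Dnext := by
  intro u v t hu hv ht
  have h0 := abs_eval_le_of_residualBound _ _ h hu hv ht
  rw [eval_append, eval_append, eval_neg, eval_FPolyK] at h0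
  have h1 : |Dprev.eval u v t + (FPolyG c.n c.d bs).eval u v t + -Dnext.eval u v t| ≤ 0 := by
    simpa using h0
  have h2 := abs_nonpos_iff.1 h1
  linarith

end Summit.Ventures.PackingBounds.ThreePointCert

end
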